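import Summits.AnomalousDissipation.AnomalousDissipation.Theorems.ImpulseGridGridSignsLawFirstMomentForm

/-!
# Line `Sketch` for crux `GridSignsLaw` (item stmt-AnomalousDissipation-14349, route ImpulseGrid) —
stub `stub_loudWakes_of_gridSignsLaw`: the grid sign law forces loud wakes

The crux `GridSignsLaw` asks for ONE grid design `(Φ, Ψ, G, c)` (fifteen design clauses) such
that every bounded-energy vanishing-viscosity drift family of global Leray–Hopf solutions forced by
`Φ • G` eventually satisfies, in one generalized long-time limit `Λ`, the two grid sign conditions.
This file proves the registered companion stub `stub_loudWakes_of_gridSignsLaw` of the lead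
skeleton (line `Sketch`, reshape 3): a NECESSARY condition of the crux. If `GridSignsLaw` holds,
then its design has a ν-uniform injection floor: every bounded-energy vanishing-viscosity drift
family admits `ι > 0`, one generalized limit `Λ` and a threshold `J` with, for all `j ≥ J`,
`ι ≤ Λ⟨(Φ•G, uⱼ)⟩` and `ι ≤ limsup_T T⁻¹∫₀ᵀ (Φ•G, uⱼ(t)) dt` — a zeroth-law-type statement
(anomalous injection for one fixed body force, uniformly over its bounded-energy Leray–Hopf wakes).

Proof. By the first-moment form of the crux (`firstMomentLaw_of_gridSignsLaw`, tree file
`ImpulseGridGridSignsLawFirstMomentForm`) the design makes every such family satisfy eventually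
`0 ≤ Λ⟨(G,uⱼ)⟩` (DC work) and `κ ≤ Λ⟨((Φ−1)•G,uⱼ)⟩` (AC work), `κ > 0`; the injection splits as
`Λ⟨(Φ•G,uⱼ)⟩ = Λ⟨(G,uⱼ)⟩ + Λ⟨((Φ−1)•G,uⱼ)⟩` (`WorkSplitTransfer.longTimeAvg_inner_sub_one_smul`),
so `ι := κ` is a floor for `Λ⟨(Φ•G,uⱼ)⟩`. Finally `Λ ≤ limsup` on functions with bounded Cesàro
means (`GeneralizedLimit.le_limsup`); the pairing `t ↦ (Φ•G, uⱼ(t))` is bounded on `t ≥ 0` by the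
sup-energy clause (`impulseGrid_abs_integral_inner_le`), hence so are its time means
(`isBoundedUnder_le_timeMean`, `isBoundedUnder_ge_timeMean`).

References: Doering–Foias 2002, §2; Foias–Manley–Rosa–Temam 2001, Ch. IV §1.3 (generalized limits
squeezed between `liminf` and `limsup`). No new definitions.
-/

noncomputable section

-- `Summit.<Summit>.<Problem>` is the tree's mandated summit-side namespace (CONVENTIONS §2); for this
-- single-conjunct summit the two coincide, so the duplicate is deliberate.
set_option linter.dupNamespace false

open MeasureTheory Set Filter Topology
open scoped InnerProductSpace RealInnerProductSpace

namespace Summit.AnomalousDissipation.AnomalousDissipation.Theorems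

open Literature.Analysis.FunctionSpaces Literature.Analysis.FunctionSpaces.Torus
open Literature.Analysis.FluidPDE Literature.Analysis.FluidPDE.Torus
open Summit.AnomalousDissipation.AnomalousDissipation.Theses.ImpulseGrid

local notation "𝕋³" => UnitAddTorus (Fin 3)
local notation "E³" => EuclideanSpace ℝ (Fin 3)

namespace LoudWakes

/-- **A generalized long-time average of a work pairing is at most its `limsup` mean.** For a
continuous steady field `F` and a global Leray–Hopf solution `u` with a sup-energy bound,
`Λ⟨(F, u)⟩ ≤ limsup_T T⁻¹∫₀ᵀ (F, u(t)) dt`: the pairing is bounded on `t ≥ 0`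
(`impulseGrid_abs_integral_inner_le`, `|∫⟪u(t),F⟫| ≤ ‖F‖_∞ (1 + 2C)/2`), so its Cesàro means are
eventually bounded above and below, and a generalized limit is squeezed below the `limsup` there
(`GeneralizedLimit.le_limsup`; Foias–Manley–Rosa–Temam 2001, Ch. IV §1.3). [folklore] -/
theorem longTimeAvg_inner_le_longTimeAvgSup (Λ : GeneralizedLimit) {ν : ℝ} {F f u₀ : 𝕋³ → E³}
    {u : ℝ → 𝕋³ → E³} (hF : Continuous F) (hu : IsGlobalLerayHopf ν (fun _ => f) u₀ u)
    (hsup : ∃ C : ℝ, ∀ t : ℝ, 0 ≤ t → kineticEnergy (u t) ≤ C) :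
    Λ.longTimeAvg (fun t => ∫ x, ⟪F x, u t x⟫) ≤ longTimeAvgSup (fun t => ∫ x, ⟪F x, u t x⟫) := by
  obtain ⟨C, hC⟩ := hsup
  obtain ⟨K, hK0, hK⟩ := exists_nonneg_forall_norm_le_of_continuous hF
  have hbd : ∀ t : ℝ, 0 < t → |∫ x, ⟪F x, u t x⟫| ≤ K * (2⁻¹ * (1 + 2 * C)) := by
    intro t ht
    have heq : (∫ x, ⟪F x, u t x⟫) = ∫ x, ⟪u t x, F x⟫ :=
      integral_congr_ae (ae_of_all _ fun x => real_inner_comm _ _)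
    rw [heq]
    exact impulseGrid_abs_integral_inner_le hu hK0 hK hC ht.le
  unfold GeneralizedLimit.longTimeAvg longTimeAvgSup
  exact Λ.le_limsup (isBoundedUnder_le_timeMean hbd) (isBoundedUnder_ge_timeMean hbd)

end LoudWakes

/-- **Stub `stub_loudWakes_of_gridSignsLaw` of line `Sketch` (crux `GridSignsLaw`,
stmt-AnomalousDissipation-14349): necessary condition — the grid sign law forces LOUD wakes.** If
`GridSignsLaw` holds then its design has a ν-uniform injection floor: every bounded-energy
vanishing-viscosity drift family admits `ι > 0`, one generalized limit `Λ` and `J` with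
`ι ≤ Λ⟨(Φ•G, u_j)⟩` and `ι ≤ limsup`-mean injection for all `j ≥ J`. Proof: by
`firstMomentLaw_of_gridSignsLaw` (tree), `0 ≤ DC` and `κ ≤ AC`, and `DC + AC = Λ⟨(Φ•G,u_j)⟩`
(`WorkSplitTransfer.longTimeAvg_inner_sub_one_smul`), so `ι := κ`; `Λ ≤ limsup` on functions with
bounded Cesàro means (`GeneralizedLimit.le_limsup`, bounds from the sup-energy clause,
`LoudWakes.longTimeAvg_inner_le_longTimeAvgSup`). This is the zeroth-law-type statement (anomalous
injection for one fixed body force, uniformly over all its bounded-energy Leray–Hopf wakes) that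
the crux is at least as strong as (Doering–Foias 2002, §2; Foias–Manley–Rosa–Temam 2001,
Ch. IV §1.3). [folklore] -/
theorem stub_loudWakes_of_gridSignsLaw :
    GridSignsLaw →
      ∃ (Φ Ψ : 𝕋³ → ℝ) (G : 𝕋³ → E³) (c : ℝ), (IsSmooth Φ ∧ IsSmooth Ψ ∧ IsSmooth G ∧
        (∀ (s : UnitAddCircle) x, Φ (x + Pi.single (1 : Fin 3) s) = Φ x ∧
          Φ (x + Pi.single (2 : Fin 3) s) = Φ x) ∧
        (∫ x, Φ x = 1) ∧
        (∀ (s : UnitAddCircle) x, Ψ (x + Pi.single (1 : Fin 3) s) = Ψ x ∧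
          Ψ (x + Pi.single (2 : Fin 3) s) = Ψ x) ∧
        (∀ (s : UnitAddCircle) x, G (x + Pi.single (0 : Fin 3) s) = G x) ∧ (∀ x, G x 0 = 0) ∧
        IsDivFree G ∧ (∀ x, partialDeriv 0 Ψ x = Φ x - 1) ∧
        (∫ x, Φ x * Ψ x * ‖G x‖ ^ 2 = 0) ∧
        IsSmooth (fun x => Φ x • G x) ∧ IsDivFree (fun x => Φ x • G x) ∧
        HasZeroMean (fun x => Φ x • G x) ∧ 0 < c) ∧
      ∀ (ν : ℕ → ℝ) (u₀ : ℕ → 𝕋³ → E³) (u : ℕ → ℝ → 𝕋³ → E³) (E : ℝ),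
        (∀ j, 0 < ν j) → Tendsto ν atTop (𝓝 0) →
        (∀ j, IsGlobalLerayHopf (ν j) (fun _ => fun x => Φ x • G x) (u₀ j) (u j)) →
        (∀ j, ∃ C : ℝ, ∀ t : ℝ, 0 ≤ t → kineticEnergy (u j t) ≤ C) →
        (∀ j, ∫ x, u₀ j x = c • EuclideanSpace.single 0 1) →
        (∀ j, meanEnergy (u j) ≤ E) →
        ∃ ι : ℝ, 0 < ι ∧ ∃ (Λ : GeneralizedLimit) (J : ℕ), ∀ j, J ≤ j →
          ι ≤ Λ.longTimeAvg (fun t => ∫ x, ⟪Φ x • G x, u j t x⟫) ∧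
          ι ≤ longTimeAvgSup (fun t => ∫ x, ⟪Φ x • G x, u j t x⟫) := by
  intro h
  obtain ⟨Φ, Ψ, G, c, ⟨hΦ, hΨ, hG, hΦinv, hΦmass, hΨinv, hGinv, hG0, hGdiv, hΨderiv, hΦΨG, hfs,
    hfd, hfm, hc⟩, hlaw⟩ := firstMomentLaw_of_gridSignsLaw h
  refine ⟨Φ, Ψ, G, c, ⟨hΦ, hΨ, hG, hΦinv, hΦmass, hΨinv, hGinv, hG0, hGdiv, hΨderiv, hΦΨG, hfs,
    hfd, hfm, hc⟩, ?_⟩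
  intro ν u₀ u E hν hν0 hu hsup hdrift hE
  obtain ⟨κ, hκ, Λ, J, hJ⟩ := hlaw ν u₀ u E hν hν0 hu hsup hdrift hE
  refine ⟨κ, hκ, Λ, J, fun j hj => ?_⟩
  obtain ⟨ha, hb⟩ := hJ j hj
  -- the injection splits into DC and AC work: `AC = W - DC`
  have hsplit := WorkSplitTransfer.longTimeAvg_inner_sub_one_smul Λ hΦ.continuous hG.continuous
    (hu j)
  have hW : κ ≤ Λ.longTimeAvg (fun t => ∫ x, ⟪Φ x • G x, u j t x⟫) := by
    rw [hsplit] at hb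
    linarith
  exact ⟨hW, hW.trans
    (LoudWakes.longTimeAvg_inner_le_longTimeAvgSup Λ hfs.continuous (hu j) (hsup j))⟩

end Summit.AnomalousDissipation.AnomalousDissipation.Theorems

end
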